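import Summits.FinalStateConjecture.FinalStateConjecture.Statement
import Literature.Geometry.Lorentzian.CausalFutureProofs

/-!
# Solo (blind) — confinement and push-up separation for the localised bag-of-gold analysis

Two elementary facts used in the localisation step of the bag-of-gold analysis of the typed final
state conjecture (`paper/bag-of-gold-note.md`, Note B, §B12.6):

* `soloBlind_subset_of_isPreconnected_of_disjoint_frontier` (CONFINEMENT) — a preconnected set
  that meets an open set `U` and never touches `frontier U` lies inside `U`.  In Note B the set is
  a connected piece of a late leaf (or the image of a connected parameter domain under a chart),
  `U` is the region on the bag side of the separating achronal boundary, and "never touches the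
  frontier" is the causal separation hypothesis.
* `soloBlind_causalFuture_subset_of_subset_causalFuture` and
  `soloBlind_causalFuture_subset_diff_of_disjoint` (PUSH-UP SEPARATION, §B12.6 (u1)) — if the
  causal futures of two pieces `A_L, A_R` of the data are disjoint and `L ⊆ J⁺(A_L)`, then
  `J⁺(L) ⊆ J⁺(A_L)` (transitivity `J⁺(J⁺(S)) = J⁺(S)`, O'Neill 1983, Ch. 14, p. 402) and hence
  `J⁺(L) ⊆ J⁺(Σ) ∖ J⁺(A_R)` for any `Σ ⊇ A_L`; in particular the settled exterior
  `J⁺(ι X) ∩ I⁻(U)` meets `J⁺(L)` only inside `J⁺(A_L)`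
  (`soloBlind_inter_causalFuture_subset_of_disjoint`).

References: B. O'Neill, *Semi-Riemannian geometry*, Academic Press 1983, Ch. 14, p. 402
(`J⁺`, transitivity of `≤`).
-/

noncomputable section

open Literature.Geometry.Lorentzian Set Filter
open scoped Manifold ContDiff Topology

set_option linter.dupNamespace false

namespace Summit.FinalStateConjecture.FinalStateConjecture.Theorems

section Confinement

variable {Z : Type*} [TopologicalSpace Z]

/-- CONFINEMENT.  A preconnected set meeting an open set `U` and disjoint from `frontier U` is
contained in `U`: it lies in the union of the disjoint open sets `U` and `(closure U)ᶜ`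
(a point of `closure U = U ∪ frontier U` off the frontier is in `U`), and meets the first. -/
theorem soloBlind_subset_of_isPreconnected_of_disjoint_frontier {S U : Set Z}
    (hS : IsPreconnected S) (hU : IsOpen U) (hne : (S ∩ U).Nonempty)
    (hfr : Disjoint S (frontier U)) : S ⊆ U := by
  refine hS.subset_left_of_subset_union (v := (closure U)ᶜ) hU
    (isClosed_closure (s := U)).isOpen_compl ?_ ?_ hne
  · exact Set.disjoint_left.mpr fun x hxU hxc => hxc (subset_closure hxU)
  · intro x hxS
    by_cases hx : x ∈ closure U
    · rw [closure_eq_self_union_frontier] at hx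
      rcases hx with hx | hx
      · exact Or.inl hx
      · exact (Set.disjoint_left.mp hfr hxS hx).elim
    · exact Or.inr hx

/-- CONFINEMENT, complementary form: a preconnected set meeting the exterior `(closure U)ᶜ` of a
set `U` and disjoint from `frontier U` misses `closure U`. -/
theorem soloBlind_disjoint_of_isPreconnected_of_disjoint_frontier {S U : Set Z}
    (hS : IsPreconnected S) (hne : (S ∩ (closure U)ᶜ).Nonempty)
    (hfr : Disjoint S (frontier U)) : Disjoint S (closure U) := by
  have hfr' : Disjoint S (frontier (closure U)ᶜ) := by
    rw [frontier_compl]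
    exact hfr.mono_right (frontier_closure_subset (s := U))
  have hsub := soloBlind_subset_of_isPreconnected_of_disjoint_frontier hS
    (isClosed_closure (s := U)).isOpen_compl hne hfr'
  exact Set.disjoint_left.mpr fun x hxS hxc => hsub hxS hxc

end Confinement

section PushUp

variable {E : Type*} [NormedAddCommGroup E] [NormedSpace ℝ E] {H : Type*} [TopologicalSpace H]
  {I : ModelWithCorners ℝ E H} {n : ℕ∞ω} {M : Type*} [TopologicalSpace M] [ChartedSpace H M]
  [IsManifold I ∞ M] {g : LorentzianMetric I n M} {τ : TimeOrientation g}

/-- PUSH-UP, first half (§B12.6 (u1)).  If `L ⊆ J⁺(A)` then `J⁺(L) ⊆ J⁺(A)`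
(`J⁺(J⁺(A)) = J⁺(A)`, O'Neill 1983, Ch. 14, p. 402). -/
theorem soloBlind_causalFuture_subset_of_subset_causalFuture [BoundarylessManifold I M]
    (hn : 2 ≤ n) {A L : Set M} (hL : L ⊆ g.causalFuture τ A) :
    g.causalFuture τ L ⊆ g.causalFuture τ A := by
  rw [← LorentzianMetric.causalFuture_causalFuture_eq (g := g) (τ := τ) hn A]
  exact LorentzianMetric.causalFuture_mono hL

/-- PUSH-UP SEPARATION (§B12.6 (u1)).  If `J⁺(A_L)` and `J⁺(A_R)` are disjoint, `A_L ⊆ Σ` and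
`L ⊆ J⁺(A_L)`, then `J⁺(L) ⊆ J⁺(Σ) ∖ J⁺(A_R)`. -/
theorem soloBlind_causalFuture_subset_diff_of_disjoint [BoundarylessManifold I M]
    (hn : 2 ≤ n) {Sig A_L A_R L : Set M} (hAL : A_L ⊆ Sig)
    (hdisj : Disjoint (g.causalFuture τ A_L) (g.causalFuture τ A_R))
    (hL : L ⊆ g.causalFuture τ A_L) :
    g.causalFuture τ L ⊆ g.causalFuture τ Sig \ g.causalFuture τ A_R := by
  intro q hq
  have hq' : q ∈ g.causalFuture τ A_L :=
    soloBlind_causalFuture_subset_of_subset_causalFuture hn hL hq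
  exact ⟨LorentzianMetric.causalFuture_mono hAL hq', fun hqR => Set.disjoint_left.mp hdisj hq' hqR⟩

/-- PUSH-UP SEPARATION for the chronological future of the left piece: under the same disjointness,
`I⁺(A_L)` does not meet `J⁺(A_R)` (`I⁺ ⊆ J⁺`). -/
theorem soloBlind_chronologicalFuture_disjoint_causalFuture {A_L A_R : Set M}
    (hdisj : Disjoint (g.causalFuture τ A_L) (g.causalFuture τ A_R)) :
    Disjoint (g.chronologicalFuture τ A_L) (g.causalFuture τ A_R) :=
  hdisj.mono_left (LorentzianMetric.chronologicalFuture_subset_causalFuture g τ A_L)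

/-- LOCALISATION OF THE EXTERIOR (§B12.6).  Under the disjointness of `J⁺(A_L)` and `J⁺(A_R)`,
any set `O ⊆ J⁺(Σ)` (e.g. the settled exterior `J⁺(ι X) ∩ I⁻(U)`) meets `J⁺(L)`, `L ⊆ J⁺(A_L)`,
only inside `J⁺(A_L) ∖ J⁺(A_R)`: what the far piece `A_R` does is causally invisible there. -/
theorem soloBlind_inter_causalFuture_subset_of_disjoint [BoundarylessManifold I M]
    (hn : 2 ≤ n) {O A_L A_R L : Set M}
    (hdisj : Disjoint (g.causalFuture τ A_L) (g.causalFuture τ A_R))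
    (hL : L ⊆ g.causalFuture τ A_L) :
    O ∩ g.causalFuture τ L ⊆ g.causalFuture τ A_L \ g.causalFuture τ A_R := by
  rintro q ⟨-, hq⟩
  have hq' : q ∈ g.causalFuture τ A_L :=
    soloBlind_causalFuture_subset_of_subset_causalFuture hn hL hq
  exact ⟨hq', fun hqR => Set.disjoint_left.mp hdisj hq' hqR⟩

end PushUp

end Summit.FinalStateConjecture.FinalStateConjecture.Theorems
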